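import Literature.RepresentationTheory.HeisenbergGroup.SchrodingerBigCellTrace
import Literature.RepresentationTheory.MoeglinVignerasWaldspurger1987.RankOneThetaLift
import Literature.NumberTheory.Automorphic.Liu2021.LemD1AsPrintedIndexedNonVacuityAtPlace
import Literature.NumberTheory.Automorphic.Liu2021.Def411WeilCarriersSurvivalNonsplit
import HarnessLib

/-!
# Finite-level character non-vanishing for the rank `1 × 1` oscillator representation (TR): assembly

Topic `RepresentationTheory/MoeglinVignerasWaldspurger1987`; namespace
`Literature.RepresentationTheory.MoeglinVignerasWaldspurger1987`.  THEOREMS ONLY.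

The statement «TR» of the character route to the `c3` wall `NonPeriodic₁₁` (cell `hodgecm-mathlib`): for a
`1 × 1` Gram matrix `t`, a non-split place `v`, a section `s₁ : U(J_t)(F_v) →* S̃p(𝕎_v)` over `ι_v` with `ω_{s₁}`
smooth, and `z₀ ∈ U(J_t)(F_v) = E_v¹` with `z₀² ≠ 1` (i.e. `ι_v(z₀)` lies in Weil's big cell), there is an open
subgroup `K₀` such that for every open `K ≤ K₀` the trace of `ω_{s₁}(z₀)` on the (finite-dimensional) space of
`ω_{s₁}(K)`-fixed vectors is NON-ZERO.  This file derives it from the generic finite-level trace formula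
`HeisenbergGroup.trace_restrict_fixed_eq_of_bigCell_family` (the value is `c · Gv ≠ 0`) and the «torus big-cell
package» of the place (the hypothesis `hpkg` of `rankOne_torusTrace_ne_zero_of_bigCellPackage`: on a small coset
`z₀K₀` the operators `ω_{s₁}(z)` are canonical words with a common kernel prefactor `c ≠ 0`, the Gauss integrals of
their diagonals over deep boxes have a common value `Gv ≠ 0`, and the cell data are uniformly bounded), supplying
the smoothness/finiteness hypothesis (W4) from `hsm₁` and the compactness of `U(J₁)(F_v)`
(`exists_finiteIndex_fixing_of_isSmooth`).

## References
* [Weil1964] A. Weil, Acta Math. 111 (1964), n° 13 (29); Chap. II n° 27.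
* [MoeglinVignerasWaldspurger1987] C. Mœglin, M.-F. Vignéras, J.-L. Waldspurger, LNM 1291 (1987), Chap. 2 II.8,
  Chap. 3 §IV.
-/

set_option autoImplicit false

noncomputable section

open NumberField IsDedekindDomain
open _root_.MeasureTheory Matrix
open scoped Matrix
open Literature.RepresentationTheory.HeisenbergGroup
open Literature.NumberTheory.GelbartRogawski1991.UnitaryDualPair.LocalSplitting (iota LocalMp localSchrodinger)
open Literature.NumberTheory.Automorphic
open Literature.NumberTheory.Automorphic.UnitaryGroup
open Literature.NumberTheory.Weil1964

namespace Literature.RepresentationTheory.MoeglinVignerasWaldspurger1987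

/-! ## §1 Smooth representations of compact groups: finite-index stabilisers inside an open subgroup -/

/-- **(W4) for smooth representations of compact groups**: for `G` compact, `ω` smooth and `K ≤ G` open, every
vector is fixed by a subgroup `K₁ ≤ K` of finite index in `K` (namely `K ∩ Stab(f)`, open in the compact `K`).
[cite: MoeglinVignerasWaldspurger1987, Chap. 2 II.8] -/
theorem exists_finiteIndex_fixing_of_isSmooth {G : Type*} [Group G] [TopologicalSpace G] [IsTopologicalGroup G]
    [CompactSpace G] {S : Type*} [AddCommGroup S] [Module ℂ S] (ω : Representation ℂ G S) (hω : ω.IsSmooth)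
    (K : Subgroup G) (hK : IsOpen (K : Set G)) (f : S) :
    ∃ K₁ : Subgroup G, K₁ ≤ K ∧ (K₁.subgroupOf K).FiniteIndex ∧ ∀ k ∈ K₁, ω k f = f := by
  refine ⟨K ⊓ ω.stabilizerSubgroup f, inf_le_left, ?_, fun k hk => (ω.mem_stabilizerSubgroup f k).1 hk.2⟩
  -- `K ∩ Stab(f)` is open in the open subgroup `K` of the compact group `G`
  have hopen : IsOpen (((K ⊓ ω.stabilizerSubgroup f).subgroupOf K : Subgroup K) : Set K) :=
    (hK.inter (hω f)).preimage continuous_subtype_val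
  haveI : Finite (K ⧸ (K ⊓ ω.stabilizerSubgroup f).subgroupOf K) := Subgroup.quotient_finite_of_isOpen' K _ hK hopen
  exact Subgroup.finiteIndex_of_finite_quotient

/-! ## §2 TR from the torus big-cell package -/

/-- **TR, from the big-cell package of the place**: with the binders of `NonPeriodic₁₁` (`RankOneThetaLiftTwistRigidityOfNonPeriodic.lean`)
up to `hsm₁` (minus `d`, `hd`, `ht`, `hs₁`, not needed here), a Haar measure `μ` on `F_v` and the conductor exponent `m` of `ψ_v`, and any
`z₀` (in the application `z₀ * z₀ ≠ 1`, which is what makes the package exist): if on an open subgroup `K₀` the operators `ω_{s₁}(z₀k)` are canonical words of the dot model with a common kernel prefactor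
`c ≠ 0`, a common deep Gauss value `Gv ≠ 0` of their diagonals and uniformly bounded cells (`hpkg`, the «torus
big-cell package»), then for every open `K ≤ K₀` and every finite-dimensional `W` = the `ω_{s₁}(K)`-fixed vectors,
`tr(ω_{s₁}(z₀) | W) ≠ 0` (it equals `c · Gv`). [cite: Weil1964, n° 13 (29) p. 160; MoeglinVignerasWaldspurger1987, Chap. 2 II.8] -/
theorem rankOne_torusTrace_ne_zero_of_bigCellPackage
    (F : Type) [Field F] [NumberField F] (E : Type) [Field E] [NumberField E] [Algebra F E]
    [Algebra.IsQuadraticExtension F E] (c : E ≃ₐ[F] E) (δ : E) (hcδ : c δ = -δ) (hδ : δ ≠ 0)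
    (t : Matrix (Fin 1) (Fin 1) F) (htd : IsUnit t.det)
    (J₁ : Matrix (Fin 1) (Fin 1) E) (hJ₁ : J₁ = t.map (algebraMap F E)) (v : HeightOneSpectrum (𝓞 F))
    (hE : IsField (UnitaryGroup.LocalRing E v))
    (s₁ : UnitaryGroup.localPi E c 1 J₁ v →* LocalMp F 1 t v)
    (hsm₁ : Representation.IsSmooth ((MpPsi.toRep (localSchrodinger F 1 t v)).comp s₁))
    (z₀ : UnitaryGroup.localPi E c 1 J₁ v)
    [MeasurableSpace (v.adicCompletion F)] [BorelSpace (v.adicCompletion F)]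
    (μ : Measure (v.adicCompletion F)) [μ.IsAddHaarMeasure] (m : ℤ) (hm : (adeleAddCharAt F v).HasConductorExp m)
    (hpkg : ∃ K₀ : Subgroup (UnitaryGroup.localPi E c 1 J₁ v), IsOpen (K₀ : Set (UnitaryGroup.localPi E c 1 J₁ v)) ∧
      ∃ (γ_ δ_ : UnitaryGroup.localPi E c 1 J₁ v →
          ((Fin 1 → v.adicCompletion F) →ₗ[v.adicCompletion F] (Fin 1 → v.adicCompletion F)))
        (B_ : UnitaryGroup.localPi E c 1 J₁ v →
          ((Fin 1 → v.adicCompletion F) ≃ₗ[v.adicCompletion F] (Fin 1 → v.adicCompletion F)))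
        (cc Gv : ℂ) (m₀ e₀ : ℤ), cc ≠ 0 ∧ Gv ≠ 0 ∧
        (∀ k ∈ K₀, ∀ f : SchwartzBruhat (Fin 1 → v.adicCompletion F),
          ((MpPsi.toRep (localSchrodinger F 1 t v)).comp s₁) (z₀ * k) f = (cc * (modSqrt (B_ k) : ℂ)) •
            ((unipOpPi (isLocallyConstant_of_isContinuousNontrivial (isContinuousNontrivial_adeleAddCharAt F v)) (γ_ k) *
              leviOpPi (B_ k) * fourierOpPi μ (isContinuousNontrivial_adeleAddCharAt F v) hm *
              unipOpPi (isLocallyConstant_of_isContinuousNontrivial (isContinuousNontrivial_adeleAddCharAt F v)) (δ_ k) :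
                SchwartzBruhat (Fin 1 → v.adicCompletion F) ≃ₗ[ℂ] SchwartzBruhat (Fin 1 → v.adicCompletion F)) f)) ∧
        (∀ k ∈ K₀, ∀ n ≤ m₀,
          ∫ x in primePowPiBox (v.adicCompletion F) (Fin 1) n,
            (((adeleAddCharAt F v) (x ⬝ᵥ (B_ k).symm x - halfForm (γ_ k) x - halfForm (δ_ k) x) : Circle) : ℂ)
              ∂(Measure.pi fun _ : Fin 1 => μ) = Gv) ∧
        (∀ k ∈ K₀, ∀ (a : ℤ) (x : Fin 1 → v.adicCompletion F), x ∈ primePowPiBox (v.adicCompletion F) (Fin 1) a →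
          γ_ k x ∈ primePowPiBox (v.adicCompletion F) (Fin 1) (a - e₀) ∧
            (B_ k).symm x ∈ primePowPiBox (v.adicCompletion F) (Fin 1) (a - e₀) ∧
              δ_ k x ∈ primePowPiBox (v.adicCompletion F) (Fin 1) (a - e₀))) :
    ∃ K₀ : Subgroup (UnitaryGroup.localPi E c 1 J₁ v), IsOpen (K₀ : Set (UnitaryGroup.localPi E c 1 J₁ v)) ∧
      ∀ K : Subgroup (UnitaryGroup.localPi E c 1 J₁ v), IsOpen (K : Set (UnitaryGroup.localPi E c 1 J₁ v)) → K ≤ K₀ →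
        ∀ (W : Submodule ℂ (SchwartzBruhat (Fin 1 → v.adicCompletion F))) [FiniteDimensional ℂ W],
          (∀ f, f ∈ W ↔ ∀ k ∈ K, ((MpPsi.toRep (localSchrodinger F 1 t v)).comp s₁) k f = f) →
          ∀ hW : ∀ w ∈ W, ((MpPsi.toRep (localSchrodinger F 1 t v)).comp s₁) z₀ w ∈ W,
            LinearMap.trace ℂ W ((((MpPsi.toRep (localSchrodinger F 1 t v)).comp s₁) z₀).restrict hW) ≠ 0 := by
  obtain ⟨K₀, hK₀, γ_, δ_, B_, cc, Gv, m₀, e₀, hcc, hGv, hW1, hW2, hW3⟩ := hpkg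
  -- the place is non-split: `U(J₁)(F_v) = E_v¹` is compact
  have hc1 : c ≠ 1 := by
    rintro rfl
    exact hδ (self_eq_neg.1 (by simpa only [AlgEquiv.one_apply] using hcδ))
  obtain ⟨w⟩ := (inferInstance : Nonempty (PlacesOver E v))
  have hw : c • w.1 = w.1 := by
    by_contra hw
    exact Liu2021.LemD1IndexedNonVacuityAtPlace.not_isField_localRing_of_split E v c w hw hE
  have hJ₁0 : J₁ 0 0 ≠ 0 := by
    rw [hJ₁, Matrix.map_apply, ne_eq, map_eq_zero_iff _ (algebraMap F E).injective]
    have h := htd.ne_zero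
    rwa [Matrix.det_fin_one] at h
  haveI : CompactSpace (localPi E c 1 J₁ v) := compactSpace_localPi_one_of_smul_eq c J₁ hc1 hJ₁0 w hw
  refine ⟨K₀, hK₀, fun K hK hKK₀ W _ hWK hW => ?_⟩
  have hW4 := exists_finiteIndex_fixing_of_isSmooth ((MpPsi.toRep (localSchrodinger F 1 t v)).comp s₁) hsm₁ K hK
  rw [trace_restrict_fixed_eq_of_bigCell_family
    (isLocallyConstant_of_isContinuousNontrivial (isContinuousNontrivial_adeleAddCharAt F v)) μ
    (isContinuousNontrivial_adeleAddCharAt F v) hm ((MpPsi.toRep (localSchrodinger F 1 t v)).comp s₁) K z₀ γ_ δ_ B_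
    cc Gv m₀ e₀ (fun k hk => hW1 k (hKK₀ hk)) (fun k hk => hW2 k (hKK₀ hk)) (fun k hk => hW3 k (hKK₀ hk)) hW4 W hWK hW]
  exact mul_ne_zero hcc hGv

end Literature.RepresentationTheory.MoeglinVignerasWaldspurger1987

end
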